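import Summits.AnomalousDissipation.AnomalousDissipation.Theorems.SolenoidalFractalHomogenisationRealisedQuasiStaticCellLawSlavedPairTrapezoid
import Summits.AnomalousDissipation.AnomalousDissipation.Theorems.SolenoidalFractalHomogenisationRealisedQuasiStaticCellLawSlavedFullSlotLadders
import HarnessLib

/-!
# K2R `RealisedQuasiStaticCellLaw`, line `floquet-bloch`, stub `stub_lowSectorDecay` (S1D): the isotropic pair functional
# on the Galerkin truncation — one principal coset, both polarisations, over one FULL slot (weak coupling, W-near regime)

Summits-side helper file (everything proved; no definitions, no named facts; `--supports stmt-AnomalousDissipation-20446`).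
The two blocks (out-of-plane along `ζ ⊥ k₀, K_j`, in-plane along the Leray directions `p_J = k̂_J × ζ`) of ONE principal
coset `k_J = k₀ + J•K_j` share the index segment, the diagonal `d_J = |k_J|²/|K_j|²`, the rate `Λ_j` and the slot coupling
`g = g₁·trapezoid`; their slow entries `y₁ = ⟪ζ, α(k₀)⟫`, `y₂ = ⟪p₀, α(k₀)⟫` are measured in a time-dependent joint form
`a|y₁|² + b|y₂|² + 2Re(c ȳ₁ y₂)` whose weights are transported by the NOMINAL slaved rates `Λ_j(d₀ + g²σ_k)` relative to a
constant target rate `λ̄` (`a' = 2(Λ(d₀+g²σ₁) − λ̄)a`, `b' = 2(Λ(d₀+g²σ₂) − λ̄)b`, `c' = (Λ(d₀+g²σ₁)+Λ(d₀+g²σ₂) − 2λ̄)c`).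
`pair_slot_contraction`: over the full slot `[pP + start j, pP + start j + τ_j]` the pair functional
`S + β(F_out + F_in)` contracts by `exp(−2(1−ε)λ̄τ_j + (80βΛ_jτ_jg₁⁴(1+g₁²σ²)/Δ³ + 96βg₁²/(ρτ_jΛ_jΔ³))/G_min)`
(`slavedPair_trapezoid` fed with the two gauged ladders of `…OutOfPlaneBlock` / `…InPlaneBlock`, dead right end of a
period's last slot included as in `…SlavedSlotOut`).
-/

set_option linter.dupNamespace false

noncomputable section

namespace Summit.AnomalousDissipation.AnomalousDissipation.Theorems.SolenoidalFractalHomogenisation.RealisedQuasiStaticCellLaw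

open Set MeasureTheory Filter Topology Function Complex Matrix
open scoped InnerProductSpace ComplexConjugate Matrix
open Literature.Analysis Literature.Analysis.FunctionSpaces Literature.Analysis.FunctionSpaces.Torus
open Literature.Analysis.FluidPDE Literature.Analysis.FluidPDE.LatticeShear
open Literature.Analysis.ODE.ThreeTermLadder
open Summit.AnomalousDissipation.AnomalousDissipation.Theorems.SolenoidalFractalHomogenisation.PermissibleCarrier

variable {k₀ : ℕ}

set_option maxHeartbeats 400000 in
/-- **Isotropic pair functional of one principal coset: contraction over a full slot (weak coupling).** Slot `j` of
the `p`-th period, `a = pP + start j`, coset `k_J = k₀ + J•K_j` on the resolved segment `Wset ∋ 0, ±1`, out-of-plane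
components along `ζ` (`ζ ⊥ k₀, K_j`), in-plane components along `p_J = k̂_J × ζr`, weights `a, b, c` on the slot with the
co-moving derivatives and two-sided bounds `G_min ≤ G ≤ G_max` (as a form), `32G_max²g₁²Λ ≤ G_min ελ̄βΔ`,
`g₁²·8/Δ + 2λ̄/Λ ≤ Δ`: the functional `a|y₁|² + b|y₂|² + 2Re(c ȳ₁y₂) + β(Σ_{J≠0}|⟪ζ,α(k_J)⟫|² + Σ_{J≠0}|⟪p_J,α(k_J)⟫|²)`
at `a + τ_j` is at most `exp(−2(1−ε)λ̄τ_j + (40β·2·Λτ_jg₁⁴(1+g₁²σ²)/Δ³ + 48β·2·g₁²/(ρτ_jΛΔ³))/G_min)` times its value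
at `a`, uniformly in `N`. -/
theorem pair_slot_contraction (W : LatticeWord k₀) {n : ℕ} (hn : 0 < n) {κ : ℝ} (hκ : 0 < κ)
    (ℓ : Fin 3 → ℤ) {w₀ : UnitAddTorus (Fin 3) → EuclideanSpace ℝ (Fin 3)}
    (hw₀ : FunctionSpaces.Torus.MemSobolev 1 (FunctionSpaces.EuclideanSpace.complexify ∘ w₀))
    (hdiv : FunctionSpaces.Torus.IsWeaklyDivFree w₀) (hmean : FunctionSpaces.Torus.HasZeroMean w₀)
    (hsupp : ∀ k : Fin 3 → ℤ, ¬ ((∃ z : Fin 3 → ℤ, k = ℓ + (n:ℤ) • z) ∨ (∃ z : Fin 3 → ℤ, k = -ℓ + (n:ℤ) • z)) →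
      UnitAddTorus.mFourierCoeff (FunctionSpaces.EuclideanSpace.complexify ∘ w₀) k = 0)
    {N : ℕ} (hBN : (Finset.univ.biUnion fun j : Fin k₀ =>
        ({(fun i => (W.phase j).m i * n), -(fun i => (W.phase j).m i * n)} : Finset (Fin 3 → ℤ))) ⊆ freqBall N)
    {T : ℝ} (p : ℕ) (j : Fin k₀) (hT : (p : ℝ) * W.period + W.start j + (W.phase j).τ ≤ T)
    (k0 : Fin 3 → ℤ) (hk : ∀ J : ℤ, k0 + J • (fun i => (W.phase j).m i * (n : ℤ)) ∈ freqBall N →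
      k0 + J • (fun i => (W.phase j).m i * (n : ℤ)) ≠ 0)
    {ζ : EuclideanSpace ℂ (Fin 3)} (hζ₀ : ∑ i, (k0 i : ℂ) * ζ i = 0)
    (hζK : ∑ i, (((fun i => (W.phase j).m i * (n : ℤ)) i : ℤ) : ℂ) * ζ i = 0)
    {ζr : Fin 3 → ℝ} (hζ1 : ζr ⬝ᵥ ζr = 1) (hζ0 : ζr ⬝ᵥ (fun i => ((k0 i : ℤ) : ℝ)) = 0)
    (hζKr : ζr ⬝ᵥ (fun i => (((fun i => (W.phase j).m i * (n : ℤ)) i : ℤ) : ℝ)) = 0)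
    {pf : ℤ → Fin 3 → ℝ}
    (hp : ∀ J : ℤ, pf J = (Real.sqrt ((fun i => (((k0 + J • (fun i => (W.phase j).m i * (n : ℤ))) i : ℤ) : ℝ)) ⬝ᵥ
        (fun i => (((k0 + J • (fun i => (W.phase j).m i * (n : ℤ))) i : ℤ) : ℝ))))⁻¹ •
        (fun i => (((k0 + J • (fun i => (W.phase j).m i * (n : ℤ))) i : ℤ) : ℝ)) ⨯₃ ζr)
    {Wset : Finset ℤ} (hW : ∀ J : ℤ, J ∈ Wset ↔ k0 + J • (fun i => (W.phase j).m i * (n : ℤ)) ∈ freqBall N)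
    (h0 : (0 : ℤ) ∈ Wset) (h1 : (1 : ℤ) ∈ Wset) (hm1 : (-1 : ℤ) ∈ Wset)
    (hs : ∀ J ∈ Wset, |pf J ⬝ᵥ pf (J + 1)| ≤ 1)
    (Λ Δ ε β σ₁ σ₂ σ lam Gmax Gmin g₁ : ℝ) (wa wb : ℝ → ℝ) (wc : ℝ → ℂ)
    (hΛ : Λ = κ * (4 * Real.pi ^ 2 * freqNormSq (fun i => (W.phase j).m i * (n : ℤ))))
    (hΔ0 : 0 < Δ) (hε : 0 ≤ ε) (hβ : 0 ≤ β) (hlam : 0 ≤ lam) (hGmin : 0 < Gmin)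
    (hgap : ∀ J ∈ Wset, J ≠ 0 →
      freqNormSq k0 / freqNormSq (fun i => (W.phase j).m i * (n : ℤ)) + Δ ≤
        freqNormSq (k0 + J • (fun i => (W.phase j).m i * (n : ℤ))) / freqNormSq (fun i => (W.phase j).m i * (n : ℤ)))
    (hσ₁ : σ₁ = 1 / (freqNormSq (k0 + (-1 : ℤ) • (fun i => (W.phase j).m i * (n : ℤ))) /
          freqNormSq (fun i => (W.phase j).m i * (n : ℤ)) - freqNormSq k0 / freqNormSq (fun i => (W.phase j).m i * (n : ℤ))) +
        1 / (freqNormSq (k0 + (1 : ℤ) • (fun i => (W.phase j).m i * (n : ℤ))) /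
          freqNormSq (fun i => (W.phase j).m i * (n : ℤ)) - freqNormSq k0 / freqNormSq (fun i => (W.phase j).m i * (n : ℤ))))
    (hσ₂ : σ₂ = (pf (-1) ⬝ᵥ pf 0) ^ 2 / (freqNormSq (k0 + (-1 : ℤ) • (fun i => (W.phase j).m i * (n : ℤ))) /
          freqNormSq (fun i => (W.phase j).m i * (n : ℤ)) - freqNormSq k0 / freqNormSq (fun i => (W.phase j).m i * (n : ℤ))) +
        (pf 0 ⬝ᵥ pf 1) ^ 2 / (freqNormSq (k0 + (1 : ℤ) • (fun i => (W.phase j).m i * (n : ℤ))) /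
          freqNormSq (fun i => (W.phase j).m i * (n : ℤ)) - freqNormSq k0 / freqNormSq (fun i => (W.phase j).m i * (n : ℤ))))
    (hσ₁le : σ₁ ≤ σ) (hσ₂le : σ₂ ≤ σ)
    (hg₁ : g₁ = 2 * Real.pi * (∑ i, (W.phase j).e i * (k0 i : ℝ)) *
        ‖Complex.exp ((W.phase j).φ * Complex.I) *
          (1 / (2 * ((2 * Real.pi * ‖latticeVec (W.phase j).m‖ : ℝ) : ℂ) * Complex.I))‖ * (1 / (n : ℝ)) / Λ)
    (hGmax : ∀ t ∈ Icc ((p : ℝ) * W.period + W.start j) ((p : ℝ) * W.period + W.start j + (W.phase j).τ),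
      wa t ≤ Gmax ∧ wb t ≤ Gmax ∧ ‖wc t‖ ≤ Gmax)
    (hG : ∀ t ∈ Icc ((p : ℝ) * W.period + W.start j) ((p : ℝ) * W.period + W.start j + (W.phase j).τ), ∀ y₁ y₂ : ℂ,
      Gmin * (‖y₁‖ ^ 2 + ‖y₂‖ ^ 2) ≤ wa t * ‖y₁‖ ^ 2 + wb t * ‖y₂‖ ^ 2 + 2 * (wc t * conj y₁ * y₂).re)
    (hβ' : 16 * Gmax ^ 2 * g₁ ^ 2 * Λ * 2 ≤ Gmin * ε * lam * β * Δ)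
    (hsmall : g₁ ^ 2 * (4 * 2 / Δ) + 2 * lam / Λ ≤ Δ)
    (hwa : ∀ t ∈ Icc ((p : ℝ) * W.period + W.start j) ((p : ℝ) * W.period + W.start j + (W.phase j).τ),
      HasDerivWithinAt wa ((2 * (Λ * (freqNormSq k0 / freqNormSq (fun i => (W.phase j).m i * (n : ℤ)) +
          (g₁ * LatticeWord.trapezoid 0 (W.phase j).τ W.ramp (t - ((p : ℝ) * W.period + W.start j))) ^ 2 * σ₁) - lam)) *
        wa t) (Icc ((p : ℝ) * W.period + W.start j) ((p : ℝ) * W.period + W.start j + (W.phase j).τ)) t)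
    (hwb : ∀ t ∈ Icc ((p : ℝ) * W.period + W.start j) ((p : ℝ) * W.period + W.start j + (W.phase j).τ),
      HasDerivWithinAt wb ((2 * (Λ * (freqNormSq k0 / freqNormSq (fun i => (W.phase j).m i * (n : ℤ)) +
          (g₁ * LatticeWord.trapezoid 0 (W.phase j).τ W.ramp (t - ((p : ℝ) * W.period + W.start j))) ^ 2 * σ₂) - lam)) *
        wb t) (Icc ((p : ℝ) * W.period + W.start j) ((p : ℝ) * W.period + W.start j + (W.phase j).τ)) t)
    (hwc : ∀ t ∈ Icc ((p : ℝ) * W.period + W.start j) ((p : ℝ) * W.period + W.start j + (W.phase j).τ),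
      HasDerivWithinAt wc ((((Λ * (freqNormSq k0 / freqNormSq (fun i => (W.phase j).m i * (n : ℤ)) +
            (g₁ * LatticeWord.trapezoid 0 (W.phase j).τ W.ramp (t - ((p : ℝ) * W.period + W.start j))) ^ 2 * σ₁) +
          Λ * (freqNormSq k0 / freqNormSq (fun i => (W.phase j).m i * (n : ℤ)) +
            (g₁ * LatticeWord.trapezoid 0 (W.phase j).τ W.ramp (t - ((p : ℝ) * W.period + W.start j))) ^ 2 * σ₂) -
          2 * lam : ℝ) : ℂ) * wc t))
        (Icc ((p : ℝ) * W.period + W.start j) ((p : ℝ) * W.period + W.start j + (W.phase j).τ)) t) :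
    wa ((p : ℝ) * W.period + W.start j + (W.phase j).τ) *
          ‖inner ℂ ζ ((pvSetup_cell W hn hκ.le ℓ hw₀ hdiv hmean hsupp).galerkinCoeffAt N
            ((p : ℝ) * W.period + W.start j + (W.phase j).τ) k0)‖ ^ 2 +
        wb ((p : ℝ) * W.period + W.start j + (W.phase j).τ) *
          ‖inner ℂ (WithLp.toLp 2 (Complex.ofReal ∘ pf 0) : EuclideanSpace ℂ (Fin 3))
            ((pvSetup_cell W hn hκ.le ℓ hw₀ hdiv hmean hsupp).galerkinCoeffAt N
              ((p : ℝ) * W.period + W.start j + (W.phase j).τ) k0)‖ ^ 2 +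
        2 * (wc ((p : ℝ) * W.period + W.start j + (W.phase j).τ) *
          conj (inner ℂ ζ ((pvSetup_cell W hn hκ.le ℓ hw₀ hdiv hmean hsupp).galerkinCoeffAt N
            ((p : ℝ) * W.period + W.start j + (W.phase j).τ) k0)) *
          inner ℂ (WithLp.toLp 2 (Complex.ofReal ∘ pf 0) : EuclideanSpace ℂ (Fin 3))
            ((pvSetup_cell W hn hκ.le ℓ hw₀ hdiv hmean hsupp).galerkinCoeffAt N
              ((p : ℝ) * W.period + W.start j + (W.phase j).τ) k0)).re +
        β * (∑ J ∈ Wset.erase 0, ‖inner ℂ ζ ((pvSetup_cell W hn hκ.le ℓ hw₀ hdiv hmean hsupp).galerkinCoeffAt N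
            ((p : ℝ) * W.period + W.start j + (W.phase j).τ) (k0 + J • (fun i => (W.phase j).m i * (n : ℤ))))‖ ^ 2 +
          ∑ J ∈ Wset.erase 0, ‖inner ℂ (WithLp.toLp 2 (Complex.ofReal ∘ pf J) : EuclideanSpace ℂ (Fin 3))
            ((pvSetup_cell W hn hκ.le ℓ hw₀ hdiv hmean hsupp).galerkinCoeffAt N
              ((p : ℝ) * W.period + W.start j + (W.phase j).τ) (k0 + J • (fun i => (W.phase j).m i * (n : ℤ))))‖ ^ 2) ≤
      Real.exp (-(2 * (1 - ε) * lam * (W.phase j).τ) +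
          (40 * β * 2 * Λ * (W.phase j).τ * g₁ ^ 4 * (1 + g₁ ^ 2 * σ ^ 2) / Δ ^ 3 +
            48 * β * 2 * g₁ ^ 2 / (W.ramp * (W.phase j).τ * Λ * Δ ^ 3)) / Gmin) *
        (wa ((p : ℝ) * W.period + W.start j) *
            ‖inner ℂ ζ ((pvSetup_cell W hn hκ.le ℓ hw₀ hdiv hmean hsupp).galerkinCoeffAt N
              ((p : ℝ) * W.period + W.start j) k0)‖ ^ 2 +
          wb ((p : ℝ) * W.period + W.start j) *
            ‖inner ℂ (WithLp.toLp 2 (Complex.ofReal ∘ pf 0) : EuclideanSpace ℂ (Fin 3))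
              ((pvSetup_cell W hn hκ.le ℓ hw₀ hdiv hmean hsupp).galerkinCoeffAt N
                ((p : ℝ) * W.period + W.start j) k0)‖ ^ 2 +
          2 * (wc ((p : ℝ) * W.period + W.start j) *
            conj (inner ℂ ζ ((pvSetup_cell W hn hκ.le ℓ hw₀ hdiv hmean hsupp).galerkinCoeffAt N
              ((p : ℝ) * W.period + W.start j) k0)) *
            inner ℂ (WithLp.toLp 2 (Complex.ofReal ∘ pf 0) : EuclideanSpace ℂ (Fin 3))
              ((pvSetup_cell W hn hκ.le ℓ hw₀ hdiv hmean hsupp).galerkinCoeffAt N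
                ((p : ℝ) * W.period + W.start j) k0)).re +
          β * (∑ J ∈ Wset.erase 0, ‖inner ℂ ζ ((pvSetup_cell W hn hκ.le ℓ hw₀ hdiv hmean hsupp).galerkinCoeffAt N
              ((p : ℝ) * W.period + W.start j) (k0 + J • (fun i => (W.phase j).m i * (n : ℤ))))‖ ^ 2 +
            ∑ J ∈ Wset.erase 0, ‖inner ℂ (WithLp.toLp 2 (Complex.ofReal ∘ pf J) : EuclideanSpace ℂ (Fin 3))
              ((pvSetup_cell W hn hκ.le ℓ hw₀ hdiv hmean hsupp).galerkinCoeffAt N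
                ((p : ℝ) * W.period + W.start j) (k0 + J • (fun i => (W.phase j).m i * (n : ℤ))))‖ ^ 2)) := by
  classical
  set hPV := pvSetup_cell W hn hκ.le ℓ hw₀ hdiv hmean hsupp with hPVdef
  set K : Fin 3 → ℤ := fun i => (W.phase j).m i * (n : ℤ) with hK
  set A : ℂ := Complex.exp ((W.phase j).φ * Complex.I) *
      (1 / (2 * ((2 * Real.pi * ‖latticeVec (W.phase j).m‖ : ℝ) : ℂ) * Complex.I)) with hA
  have hA0 : A ≠ 0 := layerAmp_ne_zero (W.phase j)
  set pc : ℤ → EuclideanSpace ℂ (Fin 3) := fun J => WithLp.toLp 2 (Complex.ofReal ∘ pf J) with hpc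
  set a : ℝ := (p : ℝ) * W.period + W.start j with ha
  set τ : ℝ := (W.phase j).τ with hτdef
  have hτ : 0 < τ := (W.phase j).τ_pos
  -- the gauged components of both blocks, the links, the coupling function, the diagonal
  set v₁ : ℝ → ℤ → ℂ := fun t J => (Complex.I * A / (‖A‖ : ℂ)) ^ (-J) * inner ℂ ζ (hPV.galerkinCoeffAt N t (k0 + J • K))
    with hv₁
  set u₂ : ℝ → ℤ → ℂ := fun t J => inner ℂ (pc J) (hPV.galerkinCoeffAt N t (k0 + J • K)) with hu₂
  set v₂ : ℝ → ℤ → ℂ := fun t J => (Complex.I * A / (‖A‖ : ℂ)) ^ (-J) * u₂ t J with hv₂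
  set s₂ : ℤ → ℝ := fun J => pf J ⬝ᵥ pf (J + 1) with hs₂def
  set g : ℝ → ℝ := fun t => g₁ * LatticeWord.trapezoid 0 τ W.ramp (t - a) with hgdef
  set d : ℤ → ℝ := fun J => freqNormSq (k0 + J • K) / freqNormSq K with hddef
  have hK0 : K ≠ 0 := cellFreq_ne_zero (W.phase j) hn
  have hKpos : 0 < freqNormSq K := by
    obtain ⟨i, hi⟩ : ∃ i, K i ≠ 0 := by
      by_contra h
      push Not at h
      exact hK0 (funext h)
    have hi' : (K i : ℝ) ≠ 0 := by exact_mod_cast hi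
    unfold freqNormSq
    exact lt_of_lt_of_le (by positivity) (Finset.single_le_sum (fun l _ => sq_nonneg ((K l : ℝ))) (Finset.mem_univ i))
  have hΛpos : 0 < Λ := by rw [hΛ]; positivity
  have hd0 : d 0 = freqNormSq k0 / freqNormSq K := by simp [hddef]
  have hd0nn : 0 ≤ d 0 := by
    rw [hd0]; unfold freqNormSq; positivity
  -- vanishing off the segment
  have hvsupp₁ : ∀ t ∈ Icc a (a + τ), ∀ J, J ∉ Wset → v₁ t J = 0 := by
    intro t _ J hJ
    have hnot : k0 + J • K ∉ freqBall N := fun h => hJ ((hW J).2 h)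
    simp only [hv₁]
    rw [Torus.PVSetup.galerkinCoeffAt, coeffExt_of_not_mem _ hnot, inner_zero_right, mul_zero]
  have hvsupp₂ : ∀ t ∈ Icc a (a + τ), ∀ J, J ∉ Wset → v₂ t J = 0 := by
    intro t _ J hJ
    have hnot : k0 + J • K ∉ freqBall N := fun h => hJ ((hW J).2 h)
    simp only [hv₂, hu₂]
    rw [Torus.PVSetup.galerkinCoeffAt, coeffExt_of_not_mem _ hnot, inner_zero_right, mul_zero]
  have hgdef' : ∀ t ∈ Icc a (a + τ), g t = g₁ * LatticeWord.trapezoid 0 τ W.ramp (t - a) := fun t _ => rfl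
  -- the two gauged ladders on the full slot
  have hderiv₁ : ∀ t ∈ Icc a (a + τ), ∀ J ∈ Wset, HasDerivWithinAt (fun t' => v₁ t' J)
      (-(Λ : ℂ) * ((d J : ℂ) * v₁ t J) -
        (g t : ℂ) * (Λ : ℂ) * ((((fun _ : ℤ => (1 : ℝ)) (J - 1) : ℝ) : ℂ) * v₁ t (J - 1) -
          (((fun _ : ℤ => (1 : ℝ)) J : ℝ) : ℂ) * v₁ t (J + 1))) (Icc a (a + τ)) t := by
    intro t ht J hJ
    have h := gaugedOut_fullSlot W hn hκ ℓ hw₀ hdiv hmean hsupp hBN p j hT k0 hζ₀ hζK Λ g₁ hΛ hg₁ J ((hW J).1 hJ) ht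
    refine h.congr_deriv ?_
    simp only [Complex.ofReal_one, one_mul]
    rfl
  have hderiv₂ : ∀ t ∈ Icc a (a + τ), ∀ J ∈ Wset, HasDerivWithinAt (fun t' => v₂ t' J)
      (-(Λ : ℂ) * ((d J : ℂ) * v₂ t J) -
        (g t : ℂ) * (Λ : ℂ) * ((s₂ (J - 1) : ℂ) * v₂ t (J - 1) - (s₂ J : ℂ) * v₂ t (J + 1))) (Icc a (a + τ)) t := by
    intro t ht J hJ
    have h := gaugedIn_fullSlot W hn hκ ℓ hw₀ hdiv hmean hsupp hBN p j hT k0 hk hζ1 hζ0 hζKr hp Λ g₁ hΛ hg₁ J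
      ((hW J).1 hJ) ht
    refine h.congr_deriv ?_
    have hs1 : s₂ (J - 1) = pf (J - 1) ⬝ᵥ pf J := by simp only [hs₂def, sub_add_cancel]
    rw [hs1]
  -- the inputs of the pair theorem
  have hs₁ : ∀ J ∈ Wset, |(fun _ : ℤ => (1 : ℝ)) J| ≤ 1 := fun J _ => by simp
  have hs₂ : ∀ J ∈ Wset, |s₂ J| ≤ 1 := fun J hJ => hs J hJ
  have hγ₁ : (fun _ : ℤ => (1 : ℝ)) 0 ^ 2 + (fun _ : ℤ => (1 : ℝ)) (-1) ^ 2 ≤ Real.sqrt 2 ^ 2 := by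
    rw [Real.sq_sqrt (by norm_num)]; norm_num
  have hγ₂ : s₂ 0 ^ 2 + s₂ (-1) ^ 2 ≤ Real.sqrt 2 ^ 2 := by
    rw [Real.sq_sqrt (by norm_num)]
    have h0' := hs 0 h0
    have h1' := hs (-1) hm1
    simp only [hs₂def, zero_add, neg_add_cancel]
    rw [zero_add] at h0'
    rw [neg_add_cancel] at h1'
    have a0 := abs_le.1 h0'
    have a1 := abs_le.1 h1'
    nlinarith [a0.1, a0.2, a1.1, a1.2]
  have hσ₁' : σ₁ = (fun _ : ℤ => (1 : ℝ)) (-1) ^ 2 / (d (-1) - d 0) + (fun _ : ℤ => (1 : ℝ)) 0 ^ 2 / (d 1 - d 0) := by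
    rw [hσ₁]; simp only [hddef, one_pow, zero_smul, add_zero]
  have hσ₂' : σ₂ = s₂ (-1) ^ 2 / (d (-1) - d 0) + s₂ 0 ^ 2 / (d 1 - d 0) := by
    rw [hσ₂]; simp only [hddef, hs₂def, zero_smul, add_zero, neg_add_cancel, zero_add]
  have hgapd : ∀ J ∈ Wset, J ≠ 0 → d 0 + Δ ≤ d J := by
    intro J hJ hJ0; simpa [hddef] using hgap J hJ hJ0
  have hβ'' : 16 * Gmax ^ 2 * g₁ ^ 2 * Λ * Real.sqrt 2 ^ 2 ≤ Gmin * ε * lam * β * Δ := by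
    rw [Real.sq_sqrt (by norm_num)]; exact hβ'
  have hsmall' : g₁ ^ 2 * (4 * Real.sqrt 2 ^ 2 / Δ) + 2 * lam / Λ ≤ Δ := by
    rw [Real.sq_sqrt (by norm_num)]; exact hsmall
  have hwa' : ∀ t ∈ Icc a (a + τ),
      HasDerivWithinAt wa ((2 * (Λ * (d 0 + g t ^ 2 * σ₁) - lam)) * wa t) (Icc a (a + τ)) t := by
    intro t ht
    refine (hwa t ht).congr_deriv ?_
    rw [hd0, hgdef' t ht]
  have hwb' : ∀ t ∈ Icc a (a + τ),
      HasDerivWithinAt wb ((2 * (Λ * (d 0 + g t ^ 2 * σ₂) - lam)) * wb t) (Icc a (a + τ)) t := by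
    intro t ht
    refine (hwb t ht).congr_deriv ?_
    rw [hd0, hgdef' t ht]
  have hwc' : ∀ t ∈ Icc a (a + τ), HasDerivWithinAt wc
      ((((Λ * (d 0 + g t ^ 2 * σ₁) + Λ * (d 0 + g t ^ 2 * σ₂) - 2 * lam : ℝ) : ℂ) * wc t)) (Icc a (a + τ)) t := by
    intro t ht
    refine (hwc t ht).congr_deriv ?_
    rw [hd0, hgdef' t ht]
  have hmain := slavedPair_trapezoid Wset h0 h1 hm1 d (fun _ : ℤ => (1 : ℝ)) s₂ Λ Δ (Real.sqrt 2) σ₁ σ₂ σ ε β lam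
    Gmax Gmin g₁ τ W.ramp a g wa wb wc v₁ v₂ hs₁ hs₂ hγ₁ hγ₂ (Real.sqrt_nonneg _) hσ₁' hσ₂' hσ₁le hσ₂le hΔ0 hgapd
    hd0nn hΛpos hε hβ hlam hGmin hGmax hG hβ'' hτ W.ramp_pos W.ramp_le hgdef' hsmall' hwa' hwb' hwc' hvsupp₁ hvsupp₂
    hderiv₁ hderiv₂
  -- remove the gauge
  have hE0₁ : ∀ t, v₁ t 0 = inner ℂ ζ (hPV.galerkinCoeffAt N t k0) := by
    intro t; simp [hv₁]
  have hE0₂ : ∀ t, v₂ t 0 = inner ℂ (pc 0) (hPV.galerkinCoeffAt N t k0) := by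
    intro t; simp [hv₂, hu₂]
  have hE₁ : ∀ t, ∑ J ∈ Wset.erase 0, ‖v₁ t J‖ ^ 2 =
      ∑ J ∈ Wset.erase 0, ‖inner ℂ ζ (hPV.galerkinCoeffAt N t (k0 + J • K))‖ ^ 2 := by
    intro t
    refine Finset.sum_congr rfl fun J _ => ?_
    simp only [hv₁]
    rw [norm_gauge_zpow_mul hA0]
  have hE₂ : ∀ t, ∑ J ∈ Wset.erase 0, ‖v₂ t J‖ ^ 2 = ∑ J ∈ Wset.erase 0, ‖u₂ t J‖ ^ 2 := by
    intro t
    refine Finset.sum_congr rfl fun J _ => ?_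
    simp only [hv₂]
    rw [norm_gauge_zpow_mul hA0]
  rw [hE0₁, hE0₁, hE0₂, hE0₂, hE₁, hE₁, hE₂, hE₂, Real.sq_sqrt (by norm_num : (0:ℝ) ≤ 2)] at hmain
  convert hmain using 3

end Summit.AnomalousDissipation.AnomalousDissipation.Theorems.SolenoidalFractalHomogenisation.RealisedQuasiStaticCellLaw

end
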